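import Literature.RingTheory.FittingIdeal.FittingLemma
import Literature.RingTheory.FittingIdeal.Functoriality
import Mathlib.Algebra.Module.FinitePresentation
import HarnessLib

/-!
# Fitting ideals of finitely presented modules are finitely generated (Stacks 07ZA (4))

Topic: `Literature/RingTheory/FittingIdeal`. For a finitely presented module `M` the Fitting
ideals `Fit_k(M)` are finitely generated: by Fitting's lemma (`Module.fittingIdeal_eq_span_det_submatrix`,
Stacks 07Z8) `Fit_k(M)` is generated by the `(n - k) × (n - k)`-minors of any finite relation
matrix of a finite presentation `Rᵐ → Rⁿ → M → 0`, a finite set.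

* `Module.exists_presentation_matrix` — a finite presentation as generators `x : Fin n → M`
  and a relation matrix `A : Matrix (Fin m) (Fin n) R` generating all relations;
* `Module.fittingIdeal_fg` — **`Fit_k(M)` is finitely generated for `M` finitely presented.**

## References

* The Stacks Project, Tag 07ZA (4), Tag 07Z8. [StacksProject]
-/

namespace Literature.RingTheory.FittingIdeal

universe u v

variable {R : Type u} [CommRing R] {M : Type v} [AddCommGroup M] [Module R M]

open Module

/-- A finitely presented module has a presentation by finitely many generators
`x : Fin n → M` and a finite relation matrix `A` whose rows generate all relations. [folklore] -/
theorem Module.exists_presentation_matrix [Module.FinitePresentation R M] :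
    ∃ (n m : ℕ) (x : Fin n → M) (A : Matrix (Fin m) (Fin n) R),
      Submodule.span R (Set.range x) = ⊤ ∧ (∀ t, ∑ l, A t l • x l = 0) ∧
      ∀ ρ : Fin n → R, ∑ l, ρ l • x l = 0 → ρ ∈ Submodule.span R (Set.range A) := by
  classical
  obtain ⟨n, K, e, hK⟩ := Module.FinitePresentation.exists_fin R M
  obtain ⟨s, hs⟩ := hK
  -- generators: the images of the standard basis vectors
  let x : Fin n → M := fun l => e.symm (K.mkQ (Pi.single l 1))
  -- relations: an enumeration of the finite generating set of `K`
  obtain ⟨m, a, ha⟩ : ∃ (m : ℕ) (a : Fin m → (Fin n → R)), Set.range a = (s : Set (Fin n → R)) :=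
    ⟨s.card, fun i => (s.equivFin.symm i : Fin n → R), by
      ext v
      simp only [Set.mem_range, Finset.mem_coe]
      constructor
      · rintro ⟨i, rfl⟩
        exact (s.equivFin.symm i).2
      · intro hv
        exact ⟨s.equivFin ⟨v, hv⟩, by simp⟩⟩
  have hsum : ∀ ρ : Fin n → R, ∑ l, ρ l • x l = e.symm (K.mkQ ρ) := fun ρ => by
    simp only [x, ← map_smul, ← map_sum]
    congr 2
    ext l
    simp [Finset.sum_apply, Pi.single_apply]
  refine ⟨n, m, x, Matrix.of a, ?_, fun t => ?_, fun ρ hρ => ?_⟩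
  · -- the `x l` generate: `e.symm ∘ mkQ` is surjective and the `Pi.single l 1` generate `Rⁿ`
    rw [eq_top_iff]
    rintro v -
    obtain ⟨w, rfl⟩ : ∃ w : Fin n → R, e.symm (K.mkQ w) = v :=
      ⟨(K.mkQ_surjective (e v)).choose, by rw [(K.mkQ_surjective (e v)).choose_spec, e.symm_apply_apply]⟩
    rw [← hsum]
    exact Submodule.sum_mem _ fun l _ => Submodule.smul_mem _ _ (Submodule.subset_span ⟨l, rfl⟩)
  · show ∑ l, a t l • x l = 0
    rw [hsum, Submodule.mkQ_apply, (Submodule.Quotient.mk_eq_zero K).mpr, map_zero]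
    rw [← hs, ← ha]
    exact Submodule.subset_span ⟨t, rfl⟩
  · rw [hsum, map_eq_zero_iff _ e.symm.injective, Submodule.mkQ_apply, Submodule.Quotient.mk_eq_zero,
      ← hs, ← ha] at hρ
    exact hρ

/-- **Fitting ideals of a finitely presented module are finitely generated** (Stacks 07ZA (4)):
`Fit_k(M)` is generated by the finitely many `(n - k) × (n - k)`-minors of a finite relation
matrix. [cite: StacksProject, Tag 07ZA] -/
theorem Module.fittingIdeal_fg [Module.FinitePresentation R M] (k : ℕ) :
    (Module.fittingIdeal R M k).FG := by
  classical
  obtain ⟨n, m, x, A, hx, hA, hgen⟩ := Module.exists_presentation_matrix (R := R) (M := M)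
  rw [Module.fittingIdeal_eq_span_det_submatrix x hx A hA hgen k]
  refine ⟨(Finset.univ : Finset ((Fin (n - k) → Fin m) × (Fin (n - k) → Fin n))).image
    fun p => Matrix.det (A.submatrix p.1 p.2), ?_⟩
  congr 1
  ext d
  simp only [Finset.coe_image, Finset.coe_univ, Set.image_univ, Set.mem_range, Prod.exists,
    Set.mem_setOf_eq]
  constructor
  · rintro ⟨τ, σ, rfl⟩
    exact ⟨τ, σ, rfl⟩
  · rintro ⟨τ, σ, rfl⟩
    exact ⟨τ, σ, rfl⟩

end Literature.RingTheory.FittingIdeal
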